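import Mathlib

/-!
# A multi-operator Fitting lemma: an Artinian–Noetherian module is spanned by the common generalized kernel of a
# commuting family of endomorphisms together with their ranges

Generic commutative algebra (Mathlib-only), used by the cell `bsd-f2-manin` (route `ManinLocalTwoThree`, crux C2
`ManinOddAtFour`, stmt-BirchSwinnertonDyer-22967) in the proof of E-imc-87 `RankOneForcesOddCongruence` (the mod-`2`
reduction `S₂(Γ₀(N); ℤ)/2` under the Hecke operators `T_ℓ`).  For ONE endomorphism `A` of a module `M` of finite
length, Fitting's lemma (Mathlib `LinearMap.eventually_codisjoint_ker_pow_range_pow`) gives `M = ker Aⁿ + range Aⁿ` for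
large `n`, in particular `M = (⨆ₙ ker Aⁿ) + range A`.  For a COMMUTING family `(A_i)_{i ∈ ι}` (any index type) we
prove `M = (⨅_i ⨆ₙ ker A_iⁿ) + (⨆_i range A_i)`: by induction over a finite set of indices on `A_j`-stable submodules,
and then for all of `ι` at once by choosing a finite set of indices whose common generalized kernel is minimal
(well-foundedness of the submodule lattice of an Artinian module).  Nothing about BSD or modular forms is used or
asserted here.
-/

-- `Summit.BirchSwinnertonDyer.BirchSwinnertonDyer` is the mandated summit-side namespace (single-conjunct summit).
set_option linter.dupNamespace false

namespace Summit.BirchSwinnertonDyer.BirchSwinnertonDyer.Theorems.ManinLocalTwoThree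

open Submodule Filter

variable {R : Type*} [CommRing R] {M : Type*} [AddCommGroup M] [Module R M]

/-- Membership in the generalized kernel `⨆ₙ ker (fⁿ)` of an endomorphism: some power of `f` kills the element
(the kernels `ker fⁿ` form an increasing chain). [folklore] -/
theorem mem_iSup_ker_pow_iff (f : Module.End R M) (x : M) :
    x ∈ (⨆ n : ℕ, LinearMap.ker (f ^ n)) ↔ ∃ n : ℕ, (f ^ n) x = 0 := by
  constructor
  · intro hx
    refine Submodule.iSup_induction (fun n : ℕ ↦ LinearMap.ker (f ^ n))
      (motive := fun y ↦ ∃ n : ℕ, (f ^ n) y = 0) hx (fun n y hy ↦ ⟨n, LinearMap.mem_ker.mp hy⟩)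
      ⟨0, by rw [map_zero]⟩ ?_
    rintro y z ⟨a, ha⟩ ⟨b, hb⟩
    refine ⟨a + b, ?_⟩
    have hy : (f ^ (a + b)) y = 0 := by
      rw [add_comm, pow_add, Module.End.mul_apply, ha, map_zero]
    have hz : (f ^ (a + b)) z = 0 := by
      rw [pow_add, Module.End.mul_apply, hb, map_zero]
    rw [map_add, hy, hz, add_zero]
  · rintro ⟨n, hn⟩
    exact Submodule.mem_iSup_of_mem n (LinearMap.mem_ker.mpr hn)

/-- The generalized kernel of `A j` is stable under every endomorphism commuting with `A j`. [folklore] -/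
theorem apply_mem_iSup_ker_pow_of_commute {A B : Module.End R M} (h : Commute A B) {x : M}
    (hx : x ∈ ⨆ n : ℕ, LinearMap.ker (A ^ n)) : B x ∈ ⨆ n : ℕ, LinearMap.ker (A ^ n) := by
  rw [mem_iSup_ker_pow_iff] at hx ⊢
  obtain ⟨n, hn⟩ := hx
  refine ⟨n, ?_⟩
  have hc : A ^ n * B = B * A ^ n := (h.pow_left n).eq
  rw [← Module.End.mul_apply, hc, Module.End.mul_apply, hn, map_zero]

/-- **Multi-operator Fitting lemma, finite form.**  Let `M` be an Artinian and Noetherian `R`-module and `(A_i)` a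
pairwise commuting family of endomorphisms.  For every finite set `s` of indices and every submodule `W` stable under
all `A_i`, `W ⊆ (W ∩ ⋂_{i ∈ s} ⨆ₙ ker A_iⁿ) + Σ_{i ∈ s} range A_i`.  Induction on `s`: Fitting's lemma for the
restriction of `A_j` to `W` splits `w = k + A_jⁿ y` (`n ≥ 1`) with `A_jⁿ k = 0`, and the induction hypothesis applies
to the `A`-stable submodule `W ∩ ⨆ₙ ker A_jⁿ ∋ k`. [folklore] -/
theorem le_inf_iInf_iSup_ker_pow_sup_iSup_range_finset [IsArtinian R M] [IsNoetherian R M] {ι : Type*}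
    (A : ι → Module.End R M) (hA : ∀ i j, Commute (A i) (A j)) (s : Finset ι) :
    ∀ W : Submodule R M, (∀ i, ∀ x ∈ W, A i x ∈ W) →
      W ≤ (W ⊓ ⨅ i ∈ s, ⨆ n : ℕ, LinearMap.ker (A i ^ n)) ⊔ ⨆ i ∈ s, LinearMap.range (A i) := by
  classical
  induction s using Finset.induction_on with
  | empty =>
    intro W _
    simp
  | insert j s hj ih =>
    intro W hW x hx
    -- Fitting's lemma for `A j` restricted to `W`
    set B : Module.End R W := (A j).restrict (hW j) with hB
    obtain ⟨n, hn, hn1⟩ : ∃ n, Codisjoint (LinearMap.ker (B ^ n)) (LinearMap.range (B ^ n)) ∧ 1 ≤ n :=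
      ((B.eventually_codisjoint_ker_pow_range_pow).and (eventually_ge_atTop 1)).exists
    have hxW : (⟨x, hx⟩ : W) ∈ LinearMap.ker (B ^ n) ⊔ LinearMap.range (B ^ n) := by
      rw [hn.eq_top]
      exact Submodule.mem_top
    obtain ⟨k, hk, r, hr, hkr⟩ := Submodule.mem_sup.mp hxW
    -- the kernel component lies in `W' = W ⊓ ⨆ₙ ker (A j)ⁿ`, an `A`-stable submodule
    have hkM : (A j ^ n) (k : M) = 0 := by
      have h0 := congrArg Subtype.val (LinearMap.mem_ker.mp hk)
      rw [hB, Module.End.pow_restrict n (hW j), LinearMap.restrict_apply] at h0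
      simpa using h0
    set W' : Submodule R M := W ⊓ ⨆ m : ℕ, LinearMap.ker (A j ^ m) with hW'
    have hW'st : ∀ i, ∀ y ∈ W', A i y ∈ W' := by
      intro i y hy
      rw [hW', Submodule.mem_inf] at hy ⊢
      exact ⟨hW i y hy.1, apply_mem_iSup_ker_pow_of_commute (hA j i) hy.2⟩
    have hkW' : (k : M) ∈ W' := by
      rw [hW', Submodule.mem_inf]
      exact ⟨k.2, (mem_iSup_ker_pow_iff _ _).mpr ⟨n, hkM⟩⟩
    have hk' := ih W' hW'st hkW'
    -- the range component lies in `range (A j)` (`n ≥ 1`)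
    have hrM : (r : M) ∈ LinearMap.range (A j) := by
      obtain ⟨y, hy⟩ := LinearMap.mem_range.mp hr
      obtain ⟨n', rfl⟩ : ∃ n', n = n' + 1 := ⟨n - 1, by omega⟩
      have h0 := congrArg Subtype.val hy
      rw [hB, Module.End.pow_restrict (n' + 1) (hW j), LinearMap.restrict_apply] at h0
      simp only at h0
      rw [← h0, pow_succ', Module.End.mul_apply]
      exact LinearMap.mem_range_self _ _
    -- assemble
    have hxkr : x = (k : M) + (r : M) := by
      have h0 := congrArg Subtype.val hkr
      simpa using h0.symm
    rw [hxkr]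
    refine Submodule.add_mem _ ?_ ?_
    · have hmono : (W' ⊓ ⨅ i ∈ s, ⨆ n : ℕ, LinearMap.ker (A i ^ n)) ⊔ ⨆ i ∈ s, LinearMap.range (A i) ≤
          (W ⊓ ⨅ i ∈ insert j s, ⨆ n : ℕ, LinearMap.ker (A i ^ n)) ⊔
            ⨆ i ∈ insert j s, LinearMap.range (A i) := by
        refine sup_le_sup ?_ ?_
        · rw [hW', Finset.iInf_insert, inf_assoc]
        · exact iSup₂_le fun i hi ↦ le_iSup₂_of_le (f := fun i _ ↦ LinearMap.range (A i)) i
            (Finset.mem_insert_of_mem hi) le_rfl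
      exact hmono hk'
    · refine Submodule.mem_sup_right ?_
      exact (le_iSup₂_of_le (f := fun i _ ↦ LinearMap.range (A i)) j (Finset.mem_insert_self j s) le_rfl) hrM

/-- For any family of endomorphisms of an Artinian module there is a finite set of indices whose common generalized
kernel is already contained in every generalized kernel of the family (a minimal element of the well-founded set of
finite intersections). [folklore] -/
theorem exists_finset_iInf_iSup_ker_pow_le [IsArtinian R M] {ι : Type*} (A : ι → Module.End R M) :
    ∃ s : Finset ι, ∀ j, (⨅ i ∈ s, ⨆ n : ℕ, LinearMap.ker (A i ^ n)) ≤ ⨆ n : ℕ, LinearMap.ker (A j ^ n) := by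
  classical
  set F : Finset ι → Submodule R M := fun s ↦ ⨅ i ∈ s, ⨆ n : ℕ, LinearMap.ker (A i ^ n) with hF
  obtain ⟨m, ⟨s, rfl⟩, hmin⟩ :=
    (wellFounded_lt (α := Submodule R M)).has_min (Set.range F) ⟨F ∅, ∅, rfl⟩
  refine ⟨s, fun j ↦ ?_⟩
  have hle : F (insert j s) ≤ F s := by
    simp only [hF, Finset.iInf_insert]
    exact inf_le_right
  have heq : F (insert j s) = F s := by
    rcases hle.lt_or_eq with hlt | heq
    · exact absurd hlt (hmin _ ⟨insert j s, rfl⟩)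
    · exact heq
  calc F s = F (insert j s) := heq.symm
    _ ≤ ⨆ n : ℕ, LinearMap.ker (A j ^ n) := by
        simp only [hF, Finset.iInf_insert]
        exact inf_le_left

/-- **Multi-operator Fitting lemma.**  For a pairwise commuting family `(A_i)_{i ∈ ι}` of endomorphisms of an Artinian
and Noetherian module `M` (e.g. a finite module), `M = (⋂_i ⨆ₙ ker A_iⁿ) + Σ_i range A_i`: every element is the sum
of an element killed by some power of EVERY `A_i` and of elements of the ranges of finitely many `A_i`. [folklore] -/
theorem top_le_iInf_iSup_ker_pow_sup_iSup_range [IsArtinian R M] [IsNoetherian R M] {ι : Type*}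
    (A : ι → Module.End R M) (hA : ∀ i j, Commute (A i) (A j)) :
    (⊤ : Submodule R M) ≤ (⨅ i, ⨆ n : ℕ, LinearMap.ker (A i ^ n)) ⊔ ⨆ i, LinearMap.range (A i) := by
  obtain ⟨s, hs⟩ := exists_finset_iInf_iSup_ker_pow_le A
  refine (le_inf_iInf_iSup_ker_pow_sup_iSup_range_finset A hA s ⊤ (fun _ _ _ ↦ Submodule.mem_top)).trans ?_
  refine sup_le_sup ?_ ?_
  · rw [top_inf_eq]
    exact le_iInf hs
  · exact iSup₂_le fun i _ ↦ le_iSup (fun i ↦ LinearMap.range (A i)) i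

end Summit.BirchSwinnertonDyer.BirchSwinnertonDyer.Theorems.ManinLocalTwoThree
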